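import Literature.Computability.QuantumComplexity.GluedTreesThm9Defs
import HarnessLib

/-!
# Glued trees, Theorem 9 (classical lower bound) — the random embedding: definitions and the invariant

This module concatenates 2 parts of the proof of `ChildsEtAl2003_thm9`, each with its own
module docstring below: part `EmbDefs`, part `EmbInv`.
-/
/-!
# Glued trees, Theorem 9 (classical lower bound) — definitions for Lemma 8

Support file for the proof of `ChildsEtAl2003_thm9` (Childs–Cleve–Deotto–Farhi–Gutmann–Spielman,
STOC 2003, §4). Lemma 8 (p. 13) bounds, for a FIXED rooted binary tree `T` with at most
`2^{n/6}` vertices, the probability that its random embedding `π` into `G'_n` (Game 5;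
`GluedTrees.pos` of `GluedTreesThm9Defs`) is improper, by `3 · 2^{-n/6}`, in two parts:
(i) `π(T)` is unlikely to climb `n/2` levels of a tree after crossing the random cycle ("`π`
must choose to move right `n/2 - 1` times in a row, which has probability `2^{1-n/2}`"), and
(ii) absent that, a cycle in `π(T)` needs two crossings of the random cycle to land in the same
height-`n/2` subtree ("the probability that the last terms on the two lists agree is bounded by
`2^{n/2}/(2^n - t)`"). This file fixes the vocabulary of the rigorous version of that argument
(theorem files `GluedTreesThm9Emb*.lean`); it proves nothing.

* §1 Ancestors `anc v u` (`u` levels up), the BLOCK of a deep vertex, `blk h v` = its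
  ancestor at depth `n + 1 - h` (the printed subtrees `S_i`, `S'_i` of height `h - 1`; the
  source takes `h - 1 = n/2`, the proof files optimise `h`), side branches `sib ℓ r` and the
  subtree relation `IsDesc`.
* §2 The abstract tree of an expansion list `par`: `parentOf`, the tree depth `tdepth`, and the
  coin-only position `aPos par c m` a node WOULD have if every move from the root went down
  (the part of `π(T)` inside the ENTRANCE tree is determined by the coins alone).
* §3 Kinds of moves of the embedding: `IsUp` (to the parent vertex), the number `upCount` of
  consecutive up-moves ending at a node, `IsCross` (along the random cycle), and `land m`, the
  last crossing node above `m` (the start of its "excursion").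
* §4 Slots: the `2^{n+1}` places of the alternating cycle, `Slot n = ZMod 2^{n+1}`, slot `2k`
  holding the left leaf `e k` and slot `2k+1` the right leaf `f k` (`slotVal`), so that the glued
  edges are exactly `{s, s+1}`; `slotOf` (inverse on leaves), and the set
  `revSlots σ par c j` of slots READ by the first `j` expansions (an expansion at a leaf reads its
  slot and both neighbouring slots — through `cross₁`/`cross₂`).
* §5 The bad events of the rigorous Lemma 8: `Deep h` (some node ends `h` consecutive
  up-moves — part (i)), `BadSpread t j` (a newly read leaf sits on the cycle within distance
  `2t+4` of an already read slot — the rigorous form of "does not lie in any subtree … return to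
  column `n/2`"), `BadBlock h j` (a newly read cross neighbour lies in a block already touched by
  the embedding or by the coin-only tree, or the two new ones share a block — part (ii)), with
  the touched blocks `occBlocks`.

## References

* [ChildsEtAl2003] A. M. Childs et al., Exponential algorithmic speedup by a quantum walk,
  STOC 2003, §4, Lemma 8 and Game 5.
-/

noncomputable section

open Literature.Computability.Complexity

namespace Literature.Computability.QuantumComplexity

namespace GluedTrees

open Finset

variable {n : ℕ}

/-! ### §1 Ancestors and blocks -/

/-- The ancestor `u` levels up (`anc v 0 = v`; stays at the root once there).
[cite: ChildsEtAl2003, §4 (Lemma 8)] -/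
def anc (v : Vertex n) : ℕ → Vertex n
  | 0 => v
  | u + 1 => parentV (anc v u)

/-- The BLOCK of a vertex for the height parameter `h`: its ancestor at depth `n + 1 - h` (the
root of the printed subtree `S_i`/`S'_i` containing it; the vertex itself if it is not that deep).
[cite: ChildsEtAl2003, §4 (Lemma 8: "divide naturally into `2^{n/2}` complete binary subtrees")] -/
def blk (h : ℕ) (v : Vertex n) : Vertex n :=
  anc v (depth v - (n + 1 - h))

/-- The root of the `r`-th SIDE BRANCH above the leaf `ℓ`: the child of the ancestor `anc ℓ r`
other than `anc ℓ (r-1)` (where an excursion that climbed `r` levels from `ℓ` turns down).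
[cite: ChildsEtAl2003, §4 (Lemma 8)] -/
def sib (ℓ : Vertex n) (r : ℕ) : Vertex n := otherChild (anc ℓ r) (anc ℓ (r - 1))

/-- `z` lies in the subtree rooted at `w` (`w` is an ancestor of `z` or `z` itself). [folklore] -/
def IsDesc (w z : Vertex n) : Prop := depth w ≤ depth z ∧ anc z (depth z - depth w) = w

/-! ### §2 The abstract tree of an expansion list -/

/-- The parent node of node `m ≥ 1` of the tree with expansion list `par` (the node expanded
at the expansion `(m-1)/2` that created it; junk `0` for the root). [cite: ChildsEtAl2003, §4 (Game 5)] -/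
def parentOf (par : List ℕ) (m : ℕ) : ℕ := par.getD ((m - 1) / 2) 0

/-- The depth of a node in the abstract tree (junk `0` on ill-founded data).
[cite: ChildsEtAl2003, §4 (Game 5)] -/
def tdepth (par : List ℕ) : ℕ → ℕ
  | 0 => 0
  | m + 1 => if parentOf par (m + 1) < m + 1 then tdepth par (parentOf par (m + 1)) + 1 else 0
decreasing_by omega

/-- The coin-only position: where node `m` lands if every move from the ENTRANCE goes DOWN
(node `2j+1` takes the child numbered by the coin `c j`, node `2j+2` the other one) — the actual
position of every node of tree depth `≤ n`. [cite: ChildsEtAl2003, §4 (Game 5 and Lemma 8)] -/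
def aPos (par : List ℕ) (c : ℕ → Bool) : ℕ → Vertex n
  | 0 => entrance n
  | m + 1 =>
    if parentOf par (m + 1) < m + 1 then
      childV (aPos par c (parentOf par (m + 1))) (if m % 2 = 0 then c (m / 2) else !c (m / 2))
    else entrance n
decreasing_by omega

/-! ### §3 Kinds of moves -/

/-- Node `m` was reached by an UP move: its position is the parent vertex of the (non-root)
position of its parent node. [cite: ChildsEtAl2003, §4 (Lemma 8 (i): "move right")] -/
def IsUp (σ : CycleDatum n) (par : List ℕ) (c : ℕ → Bool) (m : ℕ) : Prop :=
  m ≠ 0 ∧ 1 ≤ depth (pos σ par c (parentOf par m)) ∧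
    pos σ par c m = parentV (pos σ par c (parentOf par m))

/-- Node `m` was reached by a CROSS move (along the random cycle): its position and that of
its parent node are both leaves. [cite: ChildsEtAl2003, §4 (Lemma 8 (ii))] -/
def IsCross (σ : CycleDatum n) (par : List ℕ) (c : ℕ → Bool) (m : ℕ) : Prop :=
  m ≠ 0 ∧ depth (pos σ par c (parentOf par m)) = n ∧ depth (pos σ par c m) = n

open Classical in
/-- The number of consecutive UP moves ending at node `m` ("move right … times in a row").
[cite: ChildsEtAl2003, §4 (Lemma 8 (i))] -/
def upCount (σ : CycleDatum n) (par : List ℕ) (c : ℕ → Bool) : ℕ → ℕ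
  | 0 => 0
  | m + 1 =>
    if h : parentOf par (m + 1) < m + 1 ∧ IsUp σ par c (m + 1) then upCount σ par c (parentOf par (m + 1)) + 1
    else 0
decreasing_by exact h.1

open Classical in
/-- The LANDING node of `m`: the last node reached by a cross move on the path from the root
to `m` (inclusive); junk `0` if there is none (nodes inside the ENTRANCE tree).
[cite: ChildsEtAl2003, §4 (Lemma 8 (ii))] -/
def land (σ : CycleDatum n) (par : List ℕ) (c : ℕ → Bool) : ℕ → ℕ
  | 0 => 0
  | m + 1 =>
    if IsCross σ par c (m + 1) then m + 1
    else if parentOf par (m + 1) < m + 1 then land σ par c (parentOf par (m + 1)) else 0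
decreasing_by omega

/-! ### §4 Slots of the alternating cycle -/

/-- The `2^{n+1}` slots of the alternating cycle, as residues mod `2^{n+1}`: slot `2k` holds the
left leaf `e k`, slot `2k+1` the right leaf `f k`, so that the glued edges `e k — f k`,
`f k — e (k+1)` are exactly the pairs of consecutive slots `{s, s+1}`.
[cite: ChildsEtAl2003, §2 and §4 (Lemma 8 (ii): "by the construction of the random cycle")] -/
abbrev Slot (n : ℕ) : Type := ZMod (2 ^ (n + 1))

/-- The position index `⌊s/2⌋` of a slot. [cite: ChildsEtAl2003, §2] -/
def slotPos (s : Slot n) : Fin (2 ^ n) :=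
  ⟨s.val / 2, Nat.div_lt_of_lt_mul (by rw [← Nat.pow_succ']; exact s.val_lt)⟩

/-- The leaf held by a slot. [cite: ChildsEtAl2003, §2] -/
def slotVal (σ : CycleDatum n) (s : Slot n) : Vertex n :=
  if s.val % 2 = 0 then leafL n (σ.1 (slotPos s)) else leafR n (σ.2 (slotPos s))

/-- The slot holding a leaf (junk `0` at a non-leaf). [cite: ChildsEtAl2003, §2] -/
def slotOf (σ : CycleDatum n) (v : Vertex n) : Slot n :=
  if h : depth v = n then
    (if v.1 then ((2 * (σ.2.symm (leafIdx v h) : ℕ) + 1 : ℕ) : Slot n)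
      else ((2 * (σ.1.symm (leafIdx v h) : ℕ) : ℕ) : Slot n))
  else 0

/-- The slots READ by the first `j` expansions: an expansion of a node sitting at a leaf reads
the slot of that leaf and its two neighbours on the cycle (it evaluates `cross₁`, `cross₂`);
expansions at inner vertices read nothing. [cite: ChildsEtAl2003, §4 (Lemma 8 (ii))] -/
def revSlots (σ : CycleDatum n) (par : List ℕ) (c : ℕ → Bool) : ℕ → Finset (Slot n)
  | 0 => ∅
  | j + 1 =>
    revSlots σ par c j ∪
      (if depth (pos σ par c (par.getD j 0)) = n then
        {slotOf σ (pos σ par c (par.getD j 0)), slotOf σ (pos σ par c (par.getD j 0)) + 1,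
          slotOf σ (pos σ par c (par.getD j 0)) - 1}
      else ∅)

/-! ### §5 The bad events of Lemma 8 -/

/-- **Part (i) event.** Some node of the tree ends `h` consecutive UP moves (the embedding
climbed `h` levels of a tree right after crossing the cycle). [cite: ChildsEtAl2003, §4 (Lemma 8 (i))] -/
def Deep (σ : CycleDatum n) (par : List ℕ) (c : ℕ → Bool) (h : ℕ) : Prop :=
  ∃ m ≤ 2 * par.length, h ≤ upCount σ par c m

/-- The blocks TOUCHED before expansion `j`: blocks of the deep positions of the existing nodes,
and blocks of the deep coin-only positions of ALL nodes of tree depth `≤ n` (the final image of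
the tree inside the ENTRANCE tree, which the coins alone determine). [cite: ChildsEtAl2003, §4 (Lemma 8 (ii))] -/
def occBlocks (σ : CycleDatum n) (par : List ℕ) (c : ℕ → Bool) (h j : ℕ) : Finset (Vertex n) :=
  (((Finset.range (2 * j + 1)).filter fun m ↦ n + 1 - h ≤ depth (pos σ par c m)).image
      fun m ↦ blk h (pos σ par c m)) ∪
    (((Finset.range (2 * par.length + 1)).filter fun m ↦
        tdepth par m ≤ n ∧ n + 1 - h ≤ depth (aPos (n := n) par c m)).image
      fun m ↦ blk h (aPos par c m))

/-- **Spread event at expansion `j`.** The expanded node sits at a leaf whose slot is read for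
the first time and lies within cyclic distance `2t + 4` of a slot read before (two stretches of
read slots could later merge). [cite: ChildsEtAl2003, §4 (Lemma 8 (ii))] -/
def BadSpread (σ : CycleDatum n) (par : List ℕ) (c : ℕ → Bool) (t j : ℕ) : Prop :=
  depth (pos σ par c (par.getD j 0)) = n ∧
    slotOf σ (pos σ par c (par.getD j 0)) ∉ revSlots σ par c j ∧
    ∃ y ∈ revSlots σ par c j, ∃ d : ℤ, |d| ≤ 2 * t + 4 ∧ y = slotOf σ (pos σ par c (par.getD j 0)) + d

/-- **Block event at expansion `j`** (part (ii): two crossings into the same subtree). The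
expanded node sits at a leaf, and a neighbouring slot read for the first time holds a leaf whose
block is already touched, or the two newly read neighbours hold leaves of the same block.
[cite: ChildsEtAl2003, §4 (Lemma 8 (ii))] -/
def BadBlock (σ : CycleDatum n) (par : List ℕ) (c : ℕ → Bool) (h j : ℕ) : Prop :=
  depth (pos σ par c (par.getD j 0)) = n ∧
    ((∃ y ∈ ({slotOf σ (pos σ par c (par.getD j 0)) + 1, slotOf σ (pos σ par c (par.getD j 0)) - 1} :
        Finset (Slot n)) \ revSlots σ par c j, blk h (slotVal σ y) ∈ occBlocks σ par c h j) ∨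
      (slotOf σ (pos σ par c (par.getD j 0)) + 1 ∉ revSlots σ par c j ∧
        slotOf σ (pos σ par c (par.getD j 0)) - 1 ∉ revSlots σ par c j ∧
        blk h (slotVal σ (slotOf σ (pos σ par c (par.getD j 0)) + 1)) =
          blk h (slotVal σ (slotOf σ (pos σ par c (par.getD j 0)) - 1))))

end GluedTrees

end Literature.Computability.QuantumComplexity

end

/-!
# Glued trees, Theorem 9 (classical lower bound) — the inductive invariant of the rigorous Lemma 8

Support file (one definition) for the proof of `ChildsEtAl2003_thm9`. The printed Lemma 8
(Childs et al. 2003, p. 13) argues informally that, unless the random embedding `π` of the tree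
`T` climbs high in a tree after a crossing (part (i)) or two crossings of the random cycle land
in the same subtree (part (ii)), `π` is proper. The rigorous version
(`GluedTreesThm9EmbGeom`: absence of the events `Deep`, `BadSpread`, `BadBlock` of
`GluedTreesThm9EmbDefs` implies `Proper`) is an induction on the expansions, and this file
states its invariant `GeomInv σ par c t h j` about the first `2j+1` nodes:

* `nbr`: every move is along an edge of `G'_n(σ)`;
* `inj`: the positions are distinct (properness so far);
* `nonA`: a node outside the ENTRANCE tree (tree depth `> n`) is deep (depth `≥ n+1-h`), its
  landing node `land` is a cross node outside the ENTRANCE tree, and it lies in the block of its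
  landing node ("excursions stay in their subtree");
* `landBlk`, `landA`: distinct landing nodes have distinct blocks, and landing blocks avoid
  the (deep part of the) coin-only tree — the negation of part (ii);
* `up`: a node reached by an up-move sits at the ancestor of its landing leaf at height its
  up-count, and its parent node is an up node or the landing node itself;
* `down`: a node outside the ENTRANCE tree reached by a down-move hangs below its parent's
  position, its parent is an up or down node, and it lies in a side branch `sib ℓ r`,
  `1 ≤ r ≤ h - 1`, of its landing leaf `ℓ`;
* `readIff`, `readOcc`: a leaf position's slot has been read iff the node is a cross node or has
  been expanded, and every read slot holds the position of some node;
* `seg`: the read slots form "segments" — around each centre `x ∈ C` the offsets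
  `-a x … b x` (`a x, b x ≤ j + 1`), centres pairwise at cyclic distance `> 2t + 4`, and every
  not-yet-expanded cross node sits at an END of a segment.

## References

* [ChildsEtAl2003] A. M. Childs et al., Exponential algorithmic speedup by a quantum walk,
  STOC 2003, §4, Lemma 8.
-/

noncomputable section

open Literature.Computability.Complexity

namespace Literature.Computability.QuantumComplexity

namespace GluedTrees

open Finset

variable {n : ℕ}

/-- **The inductive invariant of the rigorous Lemma 8** after `j` expansions (see the module
docstring for the meaning of the fields). [cite: ChildsEtAl2003, §4 (Lemma 8)] -/
structure GeomInv (σ : CycleDatum n) (par : List ℕ) (c : ℕ → Bool) (t h j : ℕ) : Prop where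
  /-- every move is along an edge -/
  nbr : ∀ m, 1 ≤ m → m ≤ 2 * j →
    pos σ par c m ∈ (graph n σ).neighborFinset (pos σ par c (parentOf par m))
  /-- distinct nodes, distinct positions -/
  inj : ∀ m ≤ 2 * j, ∀ m' ≤ 2 * j, pos σ par c m = pos σ par c m' → m = m'
  /-- nodes outside the ENTRANCE tree are deep and stay in the block of their landing node -/
  nonA : ∀ m ≤ 2 * j, n < tdepth par m →
    n + 1 - h ≤ depth (pos σ par c m) ∧ IsCross σ par c (land σ par c m) ∧ land σ par c m ≤ m ∧
      n < tdepth par (land σ par c m) ∧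
      (land σ par c m ≠ m → ∃ i, i ≤ (m - 1) / 2 ∧ par[i]? = some (land σ par c m)) ∧
      blk h (pos σ par c m) = blk h (pos σ par c (land σ par c m))
  /-- distinct landing nodes have distinct blocks -/
  landBlk : ∀ L ≤ 2 * j, ∀ L' ≤ 2 * j, IsCross σ par c L → IsCross σ par c L' → L ≠ L' →
    blk h (pos σ par c L) ≠ blk h (pos σ par c L')
  /-- landing blocks avoid the deep part of the coin-only tree -/
  landA : ∀ L ≤ 2 * j, IsCross σ par c L → ∀ a ≤ 2 * par.length, tdepth par a ≤ n →
    n + 1 - h ≤ depth (aPos (n := n) par c a) → blk h (pos σ par c L) ≠ blk h (aPos (n := n) par c a)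
  /-- up nodes climb the ancestors of their landing leaf -/
  up : ∀ m ≤ 2 * j, IsUp σ par c m → n < tdepth par m ∧
    pos σ par c m = anc (pos σ par c (land σ par c m)) (upCount σ par c m) ∧
      (IsUp σ par c (parentOf par m) ∨ parentOf par m = land σ par c m)
  /-- down nodes outside the ENTRANCE tree hang in a side branch of their landing leaf -/
  down : ∀ m ≤ 2 * j, n < tdepth par m → ¬ IsCross σ par c m → ¬ IsUp σ par c m →
    depth (pos σ par c (parentOf par m)) < n ∧ parentV (pos σ par c m) = pos σ par c (parentOf par m) ∧
      depth (pos σ par c m) = depth (pos σ par c (parentOf par m)) + 1 ∧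
      n < tdepth par (parentOf par m) ∧ ¬ IsCross σ par c (parentOf par m) ∧
      ∃ r, 1 ≤ r ∧ r + 1 ≤ h ∧ IsDesc (sib (pos σ par c (land σ par c m)) r) (pos σ par c m)
  /-- a leaf position's slot is read iff the node is a cross node or has been expanded -/
  readIff : ∀ m ≤ 2 * j, depth (pos σ par c m) = n →
    (slotOf σ (pos σ par c m) ∈ revSlots σ par c j ↔ IsCross σ par c m ∨ ∃ i < j, par[i]? = some m)
  /-- every read slot holds the position of a node -/
  readOcc : ∀ s ∈ revSlots σ par c j, ∃ m ≤ 2 * j, depth (pos σ par c m) = n ∧ slotOf σ (pos σ par c m) = s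
  /-- the read slots form well separated segments with the pending cross nodes at their ends -/
  seg : ∃ (C : Finset (Slot n)) (a b : Slot n → ℕ),
    (∀ x ∈ C, 1 ≤ a x ∧ a x ≤ j + 1 ∧ 1 ≤ b x ∧ b x ≤ j + 1) ∧
    (∀ x ∈ C, ∀ x' ∈ C, x ≠ x' → ∀ d : ℤ, |d| ≤ 2 * t + 4 → x' ≠ x + d) ∧
    (∀ s, s ∈ revSlots σ par c j ↔ ∃ x ∈ C, ∃ d : ℤ, -(a x : ℤ) ≤ d ∧ d ≤ b x ∧ s = x + d) ∧
    (∀ m ≤ 2 * j, IsCross σ par c m → (¬ ∃ i < j, par[i]? = some m) →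
      ∃ x ∈ C, slotOf σ (pos σ par c m) = x + ((b x : ℕ) : ℤ) ∨ slotOf σ (pos σ par c m) = x + (-((a x : ℕ) : ℤ)))

end GluedTrees

end Literature.Computability.QuantumComplexity

end
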